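import Summits.BirchSwinnertonDyer.Rank1Residual.F1Sign2.GenusPacketAtTwo
import Literature.NumberTheory.EllipticCurves.BSDSelmerCMPConverseRankOneProofs
import Literature.NumberTheory.EllipticCurves.NonEisensteinPrimeOfSurjective
import Literature.NumberTheory.EllipticCurves.HeegnerHypothesisKroneckerProofs
import Literature.NumberTheory.EllipticCurves.HeegnerPointsProofs
import Literature.NumberTheory.EllipticCurves.HeegnerPointsClassesProofs
import Literature.NumberTheory.EllipticCurves.HeegnerPointsRationalityProofs
import Summits.BirchSwinnertonDyer.BirchSwinnertonDyer.Theorems.ByReductionTypeAtTwoRankOneAtTwoBigImageOddLocalOneDoorIndexLawOfKolyvaginExact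
import HarnessLib

/-!
# Cell `bsd-f1-sign2`, AN-30 (THE GENUS PACKET OF A DOOR): the two SUPPLIES and the support row of `F1Sign2/GenusPacketAtTwo.lean`
# are THEOREMS — `heegnerPointSupplyAtDoor_holds`, `noRationalTwoTorsionOfSurjective_holds` — and AN-30b ⟸ AN-30a ∧ LOWER modulo
# exactly the three named facts `hasEntireLFunction_rat`, `gross_zagier`, `kolyvagin`

PROOF FILE (seat `-ty` g9, «discharge when cheap»; statement file `F1Sign2/GenusPacketAtTwo.lean`, p629460, -an g13 MEMO-an v1.23 §2 AN-30;
REF1 §96 called SUPPLY 1 «PRINT/tree-assemblable — not assembled here» and `NoRationalTwoTorsionOfSurjective` a «support triviality»; both are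
assembled here from tree theorems only).  THEOREMS ONLY (no `def`, no `sorry`, standard axioms).
* `noRationalTwoTorsion_of_hasSurjectiveModNGaloisRep_two` / `noRationalTwoTorsionOfSurjective_holds` — `ρ̄_{W,2}` onto ⇒ `W[2]` irreducible
  (`hasIrreducibleModPGaloisRep_of_hasSurjectiveModNGaloisRep`) ⇒ `#W(ℚ)[2] = 1` (`natCard_torsionBy_eq_one_of_hasIrreducibleModPGaloisRep`) ⇒ no
  rational `(x, y)` with `2y + a₁x + a₃ = 0` (the route-independent twin of gk2's `noRationalTwoTorsion_of_hasSurjectiveModNGaloisRep`).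
* `heegnerPointSupplyAtDoor_holds` — SUPPLY 1: door-admissible ⇒ Heegner hypothesis (the lead's
  `RankOneAtTwoOneDoor.satisfiesHeegnerHypothesis_of_doorAdmissible`, imported, not restated) ⇒ `β` with `4N_W ∣ β² − d_K`
  (`exists_dvd_sq_sub_discr_holds`) ⇒ a Heegner datum (`nonempty_heegnerDatum_holds`) ⇒ the complex Heegner point has a `K`-rational
  preimage (`heegnerPointComplex_mem_range_map_holds`, Darmon Thm. 3.6).
* `genusPacketVisibilityAtTwo_of_divisibility_of_lower_of_facts` — the statement file's glue 2 with the supplies fed in: AN-30b from AN-30a,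
  the tree's `DoorIndexLawLowerCAtTwo` (p626076) and the named facts `hasEntireLFunction_rat`, `gross_zagier`, `kolyvagin` (through
  `heegnerExactExponentAtDoor_of_facts`, p629460).
PARTITION: none (support rows; AN-30a itself — the genus-packet divisibility — stays OPEN-in-tree with REF1 §96's gaps G1–G3); beyond-print theorem:
no.  BSD is not proved by any of this.  [cite: Gross1984, §I.1, §3] [cite: Darmon2004, Thm. 3.6] [cite: SilvermanAEC2009, III.2.3(d)]
-/

set_option autoImplicit false

noncomputable section

open scoped Classical

namespace Summit.BirchSwinnertonDyer.Rank1Residual.F1Sign2.GenusPacket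

open WeierstrassCurve Literature.NumberTheory.EllipticCurves Literature.NumberTheory.EllipticCurves.ModularForms
  Summit.BirchSwinnertonDyer.Rank1Residual.F1Sign2
  Summit.BirchSwinnertonDyer.BirchSwinnertonDyer.Theorems.RankOneAtTwoOneDoor

/-- **`ρ̄_{W,2}` onto ⟹ no rational `2`-torsion abscissa** (Mazur; Silverman AEC III.2.3(d)): surjectivity mod `2` gives
irreducibility of `W[2]` (`hasIrreducibleModPGaloisRep_of_hasSurjectiveModNGaloisRep`), hence `#W(ℚ)[2] = 1`
(`natCard_torsionBy_eq_one_of_hasIrreducibleModPGaloisRep`), and a rational `(x, y)` with `2y + a₁x + a₃ = 0` would be a point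
of order `2`.  (Same argument as gk2's `noRationalTwoTorsion_of_hasSurjectiveModNGaloisRep`, restated here route-independently.)
[cite: SilvermanAEC2009, III.2.3(d)] [cite: Mazur1977, Ch. III §5] -/
theorem noRationalTwoTorsion_of_hasSurjectiveModNGaloisRep_two (W : WeierstrassCurve ℚ) [W.IsElliptic]
    (hsurj : W.HasSurjectiveModNGaloisRep (2 : ℤ)) : NoRationalTwoTorsion W := by
  haveI : Fact (Nat.Prime 2) := ⟨Nat.prime_two⟩
  haveI : NeZero ((2 : ℕ) : ℚ) := ⟨by norm_num⟩
  have hirr := hasIrreducibleModPGaloisRep_of_hasSurjectiveModNGaloisRep W 2 (by simpa using hsurj)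
  have hcard := natCard_torsionBy_eq_one_of_hasIrreducibleModPGaloisRep W 2 hirr
  rintro x ⟨y, hxy, h2⟩
  have hns : W.toAffine.Nonsingular x y := (Affine.equation_iff_nonsingular (W := W)).mp hxy
  have hP2 : (Affine.Point.some x y hns : W.toAffine.Point) + Affine.Point.some x y hns = 0 :=
    Affine.Point.add_self_of_Y_eq (by rw [Affine.negY]; linear_combination h2)
  have hmem : (Affine.Point.some x y hns : W.toAffine.Point) ∈ AddSubgroup.torsionBy W.toAffine.Point ((2 : ℕ) : ℤ) := by
    rw [Submodule.mem_toAddSubgroup, Submodule.mem_torsionBy_iff, Nat.cast_ofNat, two_zsmul]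
    exact hP2
  haveI := (Nat.card_eq_one_iff_unique.mp hcard).1
  have h0 : (⟨Affine.Point.some x y hns, hmem⟩ : AddSubgroup.torsionBy W.toAffine.Point ((2 : ℕ) : ℤ)) =
      ⟨0, AddSubgroup.zero_mem _⟩ := Subsingleton.elim _ _
  exact Affine.Point.some_ne_zero hns (congrArg Subtype.val h0)

/-- **The support row `NoRationalTwoTorsionOfSurjective` of `F1Sign2/GenusPacketAtTwo.lean` holds** (its `n = 1` instance suffices). -/
theorem noRationalTwoTorsionOfSurjective_holds : NoRationalTwoTorsionOfSurjective := by
  intro W _ _ hsurj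
  exact noRationalTwoTorsion_of_hasSurjectiveModNGaloisRep_two W (by simpa using hsurj 1)

/-! ## SUPPLY 1 is PRINT, by the kernel: the Heegner point of any parametrisation datum at a door is `K`-rational -/

/-- **The support row `HeegnerPointSupplyAtDoor` of `F1Sign2/GenusPacketAtTwo.lean` holds** (Gross 1984 §3; Darmon 2004 Thm. 3.6):
door-admissible ⇒ Heegner hypothesis ⇒ `4N_W ∣ β² − d_K` for some `β` (`exists_dvd_sq_sub_discr_holds`) ⇒ a Heegner datum of level
`N_W` exists (`nonempty_heegnerDatum_holds`) ⇒ for any complex embedding `ι` the complex Heegner point of the datum has a `K`-rational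
preimage (`heegnerPointComplex_mem_range_map_holds`).  All four inputs are theorems of the tree. [cite: Gross1984, §I.1, §3] [cite: Darmon2004, Thm. 3.6] -/
theorem heegnerPointSupplyAtDoor_holds : HeegnerPointSupplyAtDoor := by
  intro W _ _ _ K _ _ hK hadm Dt
  have hH : SatisfiesHeegnerHypothesis (W.conductorNorm ℤ) K :=
    Summit.BirchSwinnertonDyer.BirchSwinnertonDyer.Theorems.RankOneAtTwoOneDoor.satisfiesHeegnerHypothesis_of_doorAdmissible W K hK hadm
  obtain ⟨β, hβ⟩ := exists_dvd_sq_sub_discr_holds (W.conductorNorm ℤ) K hK hH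
  obtain ⟨H, -⟩ := nonempty_heegnerDatum_holds (W.conductorNorm ℤ) K hK hβ
  obtain ⟨ι⟩ : Nonempty (K →+* ℂ) := inferInstance
  obtain ⟨P, hP⟩ := heegnerPointComplex_mem_range_map_holds (W.conductorNorm ℤ) W K hK hH Dt H ι
  exact ⟨H, ι, P, hP⟩

/-! ## AN-30b from AN-30a and the `≤` half, modulo three named facts (the two supplies and the support row discharged) -/

/-- **Glue 2 with the supplies discharged**: AN-30b `GenusPacketVisibilityAtTwo` follows from AN-30a `GenusPacketDivisibilityAtTwo`, the
`≤` half `DoorIndexLawLowerCAtTwo` of the one-door law (tree, p626076), and the three Literature named facts `hasEntireLFunction_rat`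
(modularity / entire continuation), `gross_zagier`, `kolyvagin` at `(N_W, W, K)` — SUPPLY 1 (`heegnerPointSupplyAtDoor_holds`), SUPPLY 2
(`heegnerExactExponentAtDoor_of_facts`) and `noRationalTwoTorsionOfSurjective_holds` being theorems.  Nothing else is assumed. -/
theorem genusPacketVisibilityAtTwo_of_divisibility_of_lower_of_facts (hA : GenusPacketDivisibilityAtTwo) (hL : DoorIndexLawLowerCAtTwo)
    (hmod : WeierstrassCurve.hasEntireLFunction_rat)
    (hGZ : ∀ (W : WeierstrassCurve ℚ) [NeZero (W.conductorNorm ℤ)] (K : Type) [Field K] [NumberField K],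
      gross_zagier (W.conductorNorm ℤ) W K)
    (hKo : ∀ (W : WeierstrassCurve ℚ) [NeZero (W.conductorNorm ℤ)] (K : Type) [Field K] [NumberField K],
      kolyvagin (W.conductorNorm ℤ) W K) :
    GenusPacketVisibilityAtTwo :=
  visibility_of_divisibility_of_lower hA hL heegnerPointSupplyAtDoor_holds (heegnerExactExponentAtDoor_of_facts hmod hGZ hKo)
    noRationalTwoTorsionOfSurjective_holds

end Summit.BirchSwinnertonDyer.Rank1Residual.F1Sign2.GenusPacket

end
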